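import Mathlib
import Literature.RingTheory.MvPowerSeries.OptionEquivLeft
import Summits.ValiantsHypothesis.ValiantsHypothesis.Theorems.BinomialElusiveBinomialCandidateCorankTwoEvaluation

/-!
# Crux `BinomialElusive.BinomialCandidate` (stmt-ValiantsHypothesis-7392), line `registered` —
# stub `stub_nondegenerateCorankTwo` (skeleton v6), helper `optionEquivLeft_truncation_link`

The link between the two eliminations of the nondegenerate corank-two argument.  Level 1 produces
`R ∈ ℂ⟦W, X₁⟧ = MvPowerSeries (Option (Fin m)) ℂ` (`none = X₁`), and the `σ`-general evaluation
lemma controls `(truncTotal n R)(T')` for `T' = Option.elim · x T`; level 2 works with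
`R' := optionEquivLeft R ∈ (ℂ⟦W⟧)⟦X₁⟧` (`Literature.RingTheory.MvPowerSeries.optionEquivLeft`) and
needs the truncated polynomial `P := Σ_{j<n} (truncTotal n [X₁^j] R') X₁^j ∈ ℂ[W][X₁]` evaluated at
`W := T`, `X₁ := x`.  We prove that the two evaluations agree modulo `t^n` when `T_i`, `x` have
positive order.

Proof.  Transport `truncTotal n R ∈ ℂ[W, X₁]` along Mathlib's polynomial splitting
`MvPolynomial.optionEquivLeft` to `Q ∈ ℂ[W][X₁]`; evaluating `Q` at (`W := T`, `X₁ := x`) is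
evaluating `truncTotal n R` at `T'` (two algebra maps agreeing on the variables).  By the two
coefficient formulas `MvPolynomial.optionEquivLeft_coeff_coeff` and `coeff_coeff_optionEquivLeft`,
the coefficient of `W^d X₁^j` in both `Q` and `P` is `[W^d X₁^j] R` whenever `j + |d| < n`, so
`Q - P` has only monomials with `j + |d| ≥ n`, and such a polynomial evaluated at series of
positive order vanishes below `t^n` (`CorankTwoEvaluation.eval₂_vanish`).
-/

-- layout Summits/ValiantsHypothesis/ValiantsHypothesis forces the duplicated namespace component
set_option linter.dupNamespace false

noncomputable section

namespace Summit.ValiantsHypothesis.ValiantsHypothesis.Theorems.BinomialCandidateStubs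

open scoped BigOperators

namespace CorankTwoLink

/-- Evaluating `MvPolynomial.optionEquivLeft H` at `X ↦ x`, `C (X s) ↦ T s` is evaluating `H` at
`o ↦ o.elim x T`. -/
theorem eval₂_optionEquivLeft_eq_aeval {R : Type*} [CommRing R] {τ A : Type*} [CommRing A]
    [Algebra R A] (T : τ → A) (x : A) (H : MvPolynomial (Option τ) R) :
    Polynomial.eval₂ (MvPolynomial.aeval T).toRingHom x (MvPolynomial.optionEquivLeft R τ H) =
      MvPolynomial.aeval (fun o : Option τ => Option.elim o x T) H := by
  set Ψ : MvPolynomial (Option τ) R →ₐ[R] A :=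
    (Polynomial.eval₂AlgHom (MvPolynomial.aeval T) x (fun a => Commute.all _ _)).comp
      (MvPolynomial.optionEquivLeft R τ).toAlgHom with hΨ
  have h1 : Ψ = MvPolynomial.aeval (fun o : Option τ => Option.elim o x T) := by
    refine MvPolynomial.algHom_ext fun o => ?_
    simp only [hΨ, AlgHom.comp_apply, MvPolynomial.aeval_X]
    cases o with
    | none => simp [MvPolynomial.optionEquivLeft_X_none]
    | some s => simp [MvPolynomial.optionEquivLeft_X_some]
  have := congrArg (fun φ => φ H) h1
  simpa [hΨ] using this

/-- Degree of a lifted exponent: `|d.optionElim j| = j + |d|`. -/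
theorem degree_optionElim_eq {σ : Type*} [Fintype σ] (d : σ →₀ ℕ) (j : ℕ) :
    (d.optionElim j).degree = j + d.degree := by
  simp [Finsupp.degree_eq_sum, Fintype.sum_option]

/-- The coefficient of `W^d X₁^j` in the split truncation `optionEquivLeft (truncTotal n R)`, for
`j + |d| < n`, is `[W^d X₁^j] R`. -/
theorem coeff_coeff_optionEquivLeft_truncTotal {σ : Type*} [Fintype σ] (n : ℕ)
    (R : MvPowerSeries (Option σ) ℂ) (j : ℕ) (d : σ →₀ ℕ) (hjd : j + d.degree < n) :
    MvPolynomial.coeff d ((MvPolynomial.optionEquivLeft ℂ σ (MvPowerSeries.truncTotal n R)).coeff j) =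
      MvPowerSeries.coeff (d.optionElim j) R := by
  rw [MvPolynomial.optionEquivLeft_coeff_coeff, MvPowerSeries.coeff_truncTotal]
  rw [degree_optionElim_eq]
  exact hjd

/-- The coefficient of `W^d X₁^j` in the truncated polynomial
`Σ_{j'<n} (truncTotal n [X₁^{j'}] (optionEquivLeft R)) X₁^{j'}`, for `j + |d| < n`, is
`[W^d X₁^j] R`. -/
theorem coeff_coeff_truncPoly {σ : Type*} [Fintype σ] (n : ℕ)
    (R : MvPowerSeries (Option σ) ℂ) (j : ℕ) (d : σ →₀ ℕ) (hjd : j + d.degree < n) :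
    MvPolynomial.coeff d ((∑ j' ∈ Finset.range n, Polynomial.monomial j'
        (MvPowerSeries.truncTotal n (PowerSeries.coeff j'
          (Literature.RingTheory.MvPowerSeries.optionEquivLeft R)))).coeff j) =
      MvPowerSeries.coeff (d.optionElim j) R := by
  classical
  rw [Polynomial.finsetSum_coeff]
  simp only [Polynomial.coeff_monomial, Finset.sum_ite_eq', Finset.mem_range]
  rw [if_pos (by omega), MvPowerSeries.coeff_truncTotal _ (by omega),
    Literature.RingTheory.MvPowerSeries.coeff_coeff_optionEquivLeft]

/-- The difference `optionEquivLeft (truncTotal n R) - Σ_{j<n} (truncTotal n [X₁^j] R') X₁^j` is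
small: it has no monomial `W^d X₁^j` with `j + |d| < n`. -/
theorem small_optionEquivLeft_truncTotal_sub {σ : Type*} [Fintype σ] (n : ℕ)
    (R : MvPowerSeries (Option σ) ℂ) :
    ∀ (j : ℕ) (d : σ →₀ ℕ), j + d.degree < n →
      MvPolynomial.coeff d ((MvPolynomial.optionEquivLeft ℂ σ (MvPowerSeries.truncTotal n R) -
        ∑ j' ∈ Finset.range n, Polynomial.monomial j'
          (MvPowerSeries.truncTotal n (PowerSeries.coeff j'
            (Literature.RingTheory.MvPowerSeries.optionEquivLeft R)))).coeff j) = 0 := by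
  intro j d hjd
  rw [Polynomial.coeff_sub, MvPolynomial.coeff_sub, coeff_coeff_optionEquivLeft_truncTotal n R j d hjd,
    coeff_coeff_truncPoly n R j d hjd, sub_self]

end CorankTwoLink

open CorankTwoLink in
/-- **Link between the two eliminations** (helper of the stub `stub_nondegenerateCorankTwo`).
For `R ∈ ℂ⟦W, X₁⟧ = MvPowerSeries (Option (Fin m)) ℂ` (`none = X₁`) and Laurent series `T_i`, `x`
of positive order, the evaluation of `truncTotal n R` at (`none ↦ x`, `some i ↦ T i`) agrees
modulo `t^n` with the evaluation (inner `aeval T`, outer `X₁ ↦ x`) of the truncated polynomial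
`Σ_{j<n} (truncTotal n [X₁^j] (optionEquivLeft R)) X₁^j`. -/
theorem optionEquivLeft_truncation_link :
    ∀ (m n : ℕ) (R : MvPowerSeries (Option (Fin m)) ℂ) (T : Fin m → LaurentSeries ℂ) (x : LaurentSeries ℂ),
      (∀ i, ∀ g : ℤ, g < 1 → (T i).coeff g = 0) → (∀ g : ℤ, g < 1 → x.coeff g = 0) →
      ∀ g : ℤ, g < n →
        (MvPolynomial.aeval (fun o : Option (Fin m) => Option.elim o x T) (MvPowerSeries.truncTotal n R)).coeff g =
          (Polynomial.eval₂ (MvPolynomial.aeval T).toRingHom x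
            (∑ j ∈ Finset.range n, Polynomial.monomial j
              (MvPowerSeries.truncTotal n (PowerSeries.coeff j
                (Literature.RingTheory.MvPowerSeries.optionEquivLeft R))))).coeff g := by
  intro m n R T x hT hx g hg
  have hvan := CorankTwoEvaluation.eval₂_vanish T hT x hx n _
    (small_optionEquivLeft_truncTotal_sub n R) g hg
  rw [Polynomial.eval₂_sub, HahnSeries.coeff_sub, sub_eq_zero, eval₂_optionEquivLeft_eq_aeval] at hvan
  exact hvan

end Summit.ValiantsHypothesis.ValiantsHypothesis.Theorems.BinomialCandidateStubs

end
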